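import Summits.Ventures.Crystal3D.Theorems.StickyWulffConstantTextureBuildRiserShared
import HarnessLib

/-!
# The RISER PACKAGE (B6), part 9: the PARTNER of a box cell across a box facet; rows (BX) and (XB) of `BoxRow`
# (lane T, crux `TextureLiminfV5`, stmt-Ventures-23912; design memo HOME/wulff-p2/g21/B6-DESIGN-g21.md §2; target `RiserPackage₇` of '…TextureBuildMeshV7')

HONEST FRAMING. Venture `Summits/Ventures/Crystal3D` (cell `crystal3d-full`), route `route-Ventures-StickyWulffConstant`, helper `--supports` the
law-v5 crux `TextureLiminfV5` (stmt-Ventures-23912).  Standard axioms; no mesh constructed; F-C1 not moved.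

* `box_partner` — a box cell `i ⊆ B_r` and a partner `i' ⊄ B_r` at a generic non-designated contact: by `Mesh₅.hBmatch₅` some column grain `g' ∈ {rtL r,
  rtR r}` is COMPLETE near the contact point (radius `4`), and the partner is `g'`-material outside every box, or a cell of a SIBLING box of the same
  column pair;
* `cert_of_default_complete_rtL` — a default (`rtR`-labelled) box cell against complete `rtL`: equal class lattices, or a horizontal datum (layer
  trichotomy + claim rule + LEMMA SH); `lawW_eq_zero_of_both_complete` — both columns complete near the contact: FREE by agreement;
* **`boxRow_out`** (BX: box cell / outside piece) and **`boxRow_in`** (XB: outside piece / box cell): the weight VANISHES.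
-/

noncomputable section

open scoped BigOperators InnerProductSpace

namespace Summit.Ventures.Crystal3D.Cruxes.TextureLiminf.TexShadow

open Summit.Ventures.Crystal3D Summit.Ventures.Crystal3D.Theorems Set

namespace Mesh₅

variable {C R₀ : ℝ} {N : ℕ} {x : Fin N → E3} {rc : RiseredCover C R₀ N x} {δ : ℝ} (μ : Mesh₅ rc δ)
  (ct : (f : Fin rc.ng) → TentCert (rc.tent f)) (τ : Fin rc.nk → ℝ)

/-! ### The partner across a box facet -/

/-- **THE PARTNER OF A BOX CELL** across a generic non-designated contact: a column grain complete near the contact point, and the partner is that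
grain's material outside every box, or a cell of a sibling box of the same column pair (`Mesh₅.hBmatch₅`). -/
theorem box_partner (hτ : ∀ k, τ k ∈ Set.Ioo (0 : ℝ) 1) {r : Fin rc.nr} {i i' : Fin (μ.riserInput ct τ).cells.M} (hne : i ≠ i')
    (hi : polytope ((μ.riserInput ct τ).cells.Hp i) ⊆ polytope (μ.HB r)) (hi' : ¬ polytope ((μ.riserInput ct τ).cells.Hp i') ⊆ polytope (μ.HB r))
    {p : E3 × ℝ} (hp : p ∈ (μ.riserInput ct τ).cells.Hp i) {y : E3} (hy : y ∈ (μ.riserInput ct τ).contact i i' p)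
    (hgen : (μ.riserInput ct τ).Generic p y) (hnd : y ∉ μ.desOf₂ p) :
    ∃ g' : Fin rc.ng, (g' = rc.rtL r ∨ g' = rc.rtR r) ∧ (∀ v ∈ rc.S g', dist y v ≤ 4 → v ∈ rc.X') ∧
      (((μ.riserInput ct τ).grain i' = g' ∧ ∀ r'', ¬ polytope ((μ.riserInput ct τ).cells.Hp i') ⊆ polytope (μ.HB r'')) ∨
        ∃ r'', r'' ≠ r ∧ (rc.rtL r'' = rc.rtL r ∧ rc.rtR r'' = rc.rtR r ∨ rc.rtL r'' = rc.rtR r ∧ rc.rtR r'' = rc.rtL r) ∧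
          polytope ((μ.riserInput ct τ).cells.Hp i') ⊆ polytope (μ.HB r'')) := by
  have hpB : p ∈ μ.HB r := (μ.riserInput ct τ).mem_of_contact_of_subset hne hp hy hgen ((μ.riserInput ct τ).HB_subset_𝓗 r) hi hi'
  have hyF : y ∈ facetOf (μ.HB r) p := (μ.riserInput ct τ).mem_facetOf_of_contact hy hi
  have hdes : p ∉ μ.desB r := fun hd => hnd (μ.mem_desOf₂ (μ.mem_desSet_B hd) (Or.inl rfl) hyF)
  obtain ⟨ρ', hρ', g', hg', hcomp, hball⟩ := μ.hBmatch₅ r p (Finset.mem_sdiff.2 ⟨hpB, hdes⟩) y hyF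
  refine ⟨g', hg', fun v hv hd => hcomp v hv (by linarith), ?_⟩
  obtain ⟨z, hz, hzd⟩ := (μ.riserInput ct τ).exists_mem_near_of_contact hy (lt_min hρ' one_pos)
  obtain ⟨z₀, hz₀⟩ := (μ.riserInput ct τ).cells.hne ((μ.riserInput ct τ).cells.idx i')
  have hzr : z ∈ Metric.ball y ρ' := Metric.mem_ball.2 (lt_of_lt_of_le hzd (min_le_left _ _))
  have hzB : z ∉ closure (polytope (μ.HB r)) := fun h =>
    Set.disjoint_left.1 ((μ.riserInput ct τ).disjoint_closure_of_not_subset ((μ.riserInput ct τ).HB_subset_𝓗 r) hi') hz h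
  rcases hball hzr with h | ((((h | h) | h) | h) | h)
  · exact absurd h hzB
  · -- territory of `g'`
    obtain ⟨jd, hjd⟩ := (μ.riserInput ct τ).exists_subset_HD_of_mem_closure hz h.1
    refine Or.inl ⟨(μ.riserInput ct τ).grain_eq_of_piece_subset_HD hjd, fun r'' h'' => ?_⟩
    exact Set.disjoint_left.1 (μ.hBD r'' g') (h'' hz₀) (mem_iUnion.2 ⟨jd, hjd hz₀⟩)
  · -- deep bottom of a prism of a cell with `fk = g'`
    obtain ⟨k, hk, hzk⟩ := mem_iUnion₂.1 h
    have hfk : μ.fk k = g' := (Finset.mem_filter.1 hk).2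
    have hsub := (μ.riserInput ct τ).subset_of_mem_closure ((μ.riserInput ct τ).HP_subset_𝓗 k) hz hzk.1
    have hlt : rc.height k z < (μ.riserInput ct τ).τ k := by
      have h2 : rc.height k z ≤ -1 := hzk.2
      show rc.height k z < τ k
      linarith [(hτ k).1]
    refine Or.inl ⟨?_, fun r'' h'' => Set.disjoint_left.1 (μ.hBP r'' k) (h'' hz₀) (hsub hz₀)⟩
    rw [(μ.riserInput ct τ).grain_eq_of_piece_subset_HP hsub, if_pos ((μ.riserInput ct τ).cutDatum_mem_T_of_height_lt hz hlt), hfk]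
  · -- deep top of a prism of a cell with `gk = g'`
    obtain ⟨k, hk, hzk⟩ := mem_iUnion₂.1 h
    have hgk : μ.gk k = g' := (Finset.mem_filter.1 hk).2
    have hsub := (μ.riserInput ct τ).subset_of_mem_closure ((μ.riserInput ct τ).HP_subset_𝓗 k) hz hzk.1
    have hgt : (μ.riserInput ct τ).τ k < rc.height k z := by
      have h2 : (rc.cell k).h + 1 ≤ rc.height k z := hzk.2
      show τ k < rc.height k z
      linarith [(hτ k).2, (rc.cell k).hh]
    refine Or.inl ⟨?_, fun r'' h'' => Set.disjoint_left.1 (μ.hBP r'' k) (h'' hz₀) (hsub hz₀)⟩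
    rw [(μ.riserInput ct τ).grain_eq_of_piece_subset_HP hsub, if_neg ((μ.riserInput ct τ).cutDatum_not_mem_T_of_lt_height hz hgt), hgk]
  · -- a gap piece labelled `g'`
    obtain ⟨l, hl, hzl⟩ := mem_iUnion₂.1 h
    have hll : μ.lab l = g' := (Finset.mem_filter.1 hl).2
    have hsub := (μ.riserInput ct τ).subset_of_mem_closure ((μ.riserInput ct τ).HQ_subset_𝓗 l) hz hzl
    refine Or.inl ⟨by rw [(μ.riserInput ct τ).grain_eq_of_piece_subset_HQ hsub, hll], fun r'' h'' => Set.disjoint_left.1 (μ.hBQ r'' l) (h'' hz₀) (hsub hz₀)⟩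
  · -- a sibling box of the same column pair
    obtain ⟨r'', hr'', hzr''⟩ := mem_iUnion₂.1 h
    have hsub := (μ.riserInput ct τ).subset_of_mem_closure ((μ.riserInput ct τ).HB_subset_𝓗 r'') hz hzr''
    obtain ⟨hne'', hpair⟩ := (Finset.mem_filter.1 hr'').2
    exact Or.inr ⟨r'', hne'', hpair, hsub⟩

/-! ### A default box cell against complete `rtL`; both columns complete -/

/-- **DEFAULT CELL vs COMPLETE `f = rtL r`**: a `g`-labelled box cell at a generic contact with a column-grain partner, `f` complete near the contact
point: the class lattices agree, or the facet datum is horizontal. -/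
theorem cert_of_default_complete_rtL {r : Fin rc.nr} {i i' : Fin (μ.riserInput ct τ).cells.M} (hne : i ≠ i')
    (hi : polytope ((μ.riserInput ct τ).cells.Hp i) ⊆ polytope (μ.HB r)) (hgi : (μ.riserInput ct τ).grain i = rc.rtR r)
    (hgi' : (μ.riserInput ct τ).grain i' = rc.rtL r ∨ (μ.riserInput ct τ).grain i' = rc.rtR r)
    {p : E3 × ℝ} (hp : p ∈ (μ.riserInput ct τ).cells.Hp i) {y : E3} (hy : y ∈ (μ.riserInput ct τ).contact i i' p)
    (hgen : (μ.riserInput ct τ).Generic p y) (hcomp : ∀ v ∈ rc.S (rc.rtL r), dist y v ≤ 4 → v ∈ rc.X') :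
    (rc.tent ((μ.riserInput ct τ).grain i)).frame ((μ.riserInput ct τ).slab i) '' fccRef =
        (rc.tent ((μ.riserInput ct τ).grain i')).frame ((μ.riserInput ct τ).slab i') '' fccRef ∨
      (p.1 = rc.rn r ∨ p.1 = -rc.rn r) := by
  rcases μ.layer_trichotomy r (μ.rheight r y) with ⟨m, hm, hlo, hhi⟩ | ⟨hs0, hs1⟩
  · exact Or.inr (μ.fst_eq_pm_rn_of_complete_rtL ct τ hi hgi hp hy.1.1 hy.1.2 hgen (fun v hv hd => hcomp v hv (by linarith)) hm hlo hhi)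
  · by_cases h1 : p.1 = rc.rn r
    · exact Or.inr (Or.inl h1)
    by_cases h2 : p.1 = -rc.rn r
    · exact Or.inr (Or.inr h2)
    exact Or.inl ((μ.riserInput ct τ).lattice_eq_of_shared_contact r hne (Or.inr hgi) hgi' hp hy hgen hs0 hs1 h1 h2)

/-- **BOTH COLUMNS COMPLETE near the contact point ⇒ FREE** (agreement on `ball y 3`, frame witness «two layerings»). -/
theorem lawW_eq_zero_of_both_complete {r : Fin rc.nr} {i i' : Fin (μ.riserInput ct τ).cells.M}
    (hgi : (μ.riserInput ct τ).grain i = rc.rtL r ∨ (μ.riserInput ct τ).grain i = rc.rtR r)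
    (hgi' : (μ.riserInput ct τ).grain i' = rc.rtL r ∨ (μ.riserInput ct τ).grain i' = rc.rtR r)
    (hg : (μ.riserInput ct τ).grain i' ≠ (μ.riserInput ct τ).grain i)
    {p : E3 × ℝ} {y : E3} (hy : y ∈ (μ.riserInput ct τ).contact i i' p) (hgen : (μ.riserInput ct τ).Generic p y)
    (hcf : ∀ v ∈ rc.S (rc.rtL r), dist y v ≤ 4 → v ∈ rc.X') (hcg : ∀ v ∈ rc.S (rc.rtR r), dist y v ≤ 4 → v ∈ rc.X') :
    lawW (μ.riserInput ct τ).frameOf ((μ.riserInput ct τ).cells.cls i) ((μ.riserInput ct τ).cells.cls i') p.1 = 0 := by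
  have hS := μ.S_inter_ball_eq_of_complete r hcf hcg
  have hball : Metric.closedBall y 2 ⊆ Metric.ball y 3 := Metric.closedBall_subset_ball (by norm_num)
  have hW := μ.frameWitness r
  -- the two grains are `f, g` in some order
  have hcases : ((μ.riserInput ct τ).grain i = rc.rtL r ∧ (μ.riserInput ct τ).grain i' = rc.rtR r) ∨ ((μ.riserInput ct τ).grain i = rc.rtR r ∧ (μ.riserInput ct τ).grain i' = rc.rtL r) := by
    rcases hgi with h | h <;> rcases hgi' with h' | h'
    · exact absurd (h'.trans h.symm) hg
    · exact Or.inl ⟨h, h'⟩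
    · exact Or.inr ⟨h, h'⟩
    · exact absurd (h'.trans h.symm) hg
  rcases hcases with ⟨h, h'⟩ | ⟨h, h'⟩
  · refine (μ.riserInput ct τ).lawW_eq_zero_of_agreement hy hgen hball (by rw [h, h']; exact hS) ?_
    rw [h, h']
    rcases hW with hpar | ⟨A, u, hA⟩ | ⟨A, u, hA⟩
    · exact Or.inl hpar
    · exact Or.inr ⟨A, u, fun v hv => hA hv.1⟩
    · exact Or.inr ⟨A, u, fun v hv => hA (by rw [hS] at hv; exact hv.1)⟩
  · refine (μ.riserInput ct τ).lawW_eq_zero_of_agreement hy hgen hball (by rw [h, h']; exact hS.symm) ?_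
    rw [h, h']
    rcases hW with hpar | ⟨A, u, hA⟩ | ⟨A, u, hA⟩
    · left
      rcases hpar with e | e
      · exact Or.inl e.symm
      · exact Or.inr (by rw [e, neg_neg])
    · exact Or.inr ⟨A, u, fun v hv => hA (by rw [← hS] at hv; exact hv.1)⟩
    · exact Or.inr ⟨A, u, fun v hv => hA hv.1⟩

/-! ### Rows (BX) and (XB) -/

/-- **ROW (BX)**: a box cell and a partner outside every box, different grains, generic non-designated contact: the weight VANISHES. -/
theorem boxRow_out (hτ : ∀ k, τ k ∈ Set.Ioo (0 : ℝ) 1) {r : Fin rc.nr} {i i' : Fin (μ.riserInput ct τ).cells.M}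
    (hi : polytope ((μ.riserInput ct τ).cells.Hp i) ⊆ polytope (μ.HB r)) (hi' : ∀ r'', ¬ polytope ((μ.riserInput ct τ).cells.Hp i') ⊆ polytope (μ.HB r''))
    (hg : (μ.riserInput ct τ).grain i' ≠ (μ.riserInput ct τ).grain i) {p : E3 × ℝ} (hp : p ∈ (μ.riserInput ct τ).cells.Hp i) {y : E3}
    (hy : y ∈ (μ.riserInput ct τ).contact i i' p) (hgen : (μ.riserInput ct τ).Generic p y) (hnd : y ∉ μ.desOf₂ p) :
    lawW (μ.riserInput ct τ).frameOf ((μ.riserInput ct τ).cells.cls i) ((μ.riserInput ct τ).cells.cls i') p.1 = 0 := by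
  have hne : i ≠ i' := fun e => hg (by rw [e])
  obtain ⟨g', hg'c, hcomp, hmat⟩ := μ.box_partner ct τ hτ hne hi (hi' r) hp hy hgen hnd
  rcases hmat with ⟨hgi', -⟩ | ⟨r'', -, -, hsub⟩
  · rcases hg'c with rfl | rfl
    · -- `f` complete: `i` is the default cell
      have hgi : (μ.riserInput ct τ).grain i = rc.rtR r := by
        rcases μ.grain_box_mem ct τ hi with h | h
        · exact absurd (hgi'.trans h.symm) hg
        · exact h
      rcases μ.cert_of_default_complete_rtL ct τ hne hi hgi (Or.inl hgi') hp hy hgen hcomp with hlat | hpm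
      · exact (μ.riserInput ct τ).lawW_eq_zero_of_lattice_eq hlat p.1
      · exact μ.lawW_columns_eq_zero_of_pm_rn' ct τ hgi hgi' hpm
    · -- `g` complete: `i` would be `f`-claimed — impossible
      have hgi : (μ.riserInput ct τ).grain i = rc.rtL r := by
        rcases μ.grain_box_mem ct τ hi with h | h
        · exact h
        · exact absurd (hgi'.trans h.symm) hg
      exact (μ.false_of_claimed_of_complete_rtR ct τ hi hgi hy.1.1 (fun v hv hd => hcomp v hv (by linarith))).elim
  · exact absurd hsub (hi' r'')

/-- **ROW (XB)**: a piece outside every box and a box cell, different grains, generic non-designated contact: the weight VANISHES. -/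
theorem boxRow_in (hτ : ∀ k, τ k ∈ Set.Ioo (0 : ℝ) 1) {r : Fin rc.nr} {i i' : Fin (μ.riserInput ct τ).cells.M}
    (hi : ∀ r'', ¬ polytope ((μ.riserInput ct τ).cells.Hp i) ⊆ polytope (μ.HB r'')) (hi' : polytope ((μ.riserInput ct τ).cells.Hp i') ⊆ polytope (μ.HB r))
    (hg : (μ.riserInput ct τ).grain i' ≠ (μ.riserInput ct τ).grain i) {p : E3 × ℝ} (hp : p ∈ (μ.riserInput ct τ).cells.Hp i) {y : E3}
    (hy : y ∈ (μ.riserInput ct τ).contact i i' p) (hgen : (μ.riserInput ct τ).Generic p y) (hnd : y ∉ μ.desOf₂ p) :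
    lawW (μ.riserInput ct τ).frameOf ((μ.riserInput ct τ).cells.cls i) ((μ.riserInput ct τ).cells.cls i') p.1 = 0 := by
  have hne : i ≠ i' := fun e => hg (by rw [e])
  have hp' : antip p ∈ (μ.riserInput ct τ).cells.Hp i' := (μ.riserInput ct τ).antip_mem_Hp_of_contact hne hp hy hgen
  have hy' : y ∈ (μ.riserInput ct τ).contact i' i (antip p) := (μ.riserInput ct τ).contact_symm hy
  have hgen' : (μ.riserInput ct τ).Generic (antip p) y := (μ.riserInput ct τ).generic_antip hgen
  have hnd' : y ∉ μ.desOf₂ (antip p) := by rw [μ.desOf₂_antip]; exact hnd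
  obtain ⟨g', hg'c, hcomp, hmat⟩ := μ.box_partner ct τ hτ hne.symm hi' (hi r) hp' hy' hgen' hnd'
  rcases hmat with ⟨hgi, -⟩ | ⟨r'', -, -, hsub⟩
  · rcases hg'c with rfl | rfl
    · -- `f` complete: the box cell `i'` is the default cell
      have hgi' : (μ.riserInput ct τ).grain i' = rc.rtR r := by
        rcases μ.grain_box_mem ct τ hi' with h | h
        · exact absurd (h.trans hgi.symm) hg
        · exact h
      rcases μ.cert_of_default_complete_rtL ct τ hne.symm hi' hgi' (Or.inl hgi) hp' hy' hgen' hcomp with hlat | hpm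
      · exact (μ.riserInput ct τ).lawW_eq_zero_of_lattice_eq hlat.symm p.1
      · refine μ.lawW_columns_eq_zero_of_pm_rn ct τ hgi hgi' ?_
        simp only [antip] at hpm
        rcases hpm with h | h
        · right; rw [← h, neg_neg]
        · left; exact neg_injective h
    · -- `g` complete: the box cell `i'` would be `f`-claimed — impossible
      have hgi' : (μ.riserInput ct τ).grain i' = rc.rtL r := by
        rcases μ.grain_box_mem ct τ hi' with h | h
        · exact h
        · exact absurd (h.trans hgi.symm) hg
      exact (μ.false_of_claimed_of_complete_rtR ct τ hi' hgi' hy.2 (fun v hv hd => hcomp v hv (by linarith))).elim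
  · exact absurd hsub (hi r'')

end Mesh₅

end Summit.Ventures.Crystal3D.Cruxes.TextureLiminf.TexShadow

end
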